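import Literature.NumberTheory.EllipticCurves.ModularSymbolsParabolicCohomologyProofs
import Mathlib.LinearAlgebra.FiniteDimensional.Lemmas
import HarnessLib

/-!
# Homomorphisms `Γ₀(N) → F` killing the parabolic AND the elliptic elements: the count
# `dim_F Z¹_EP(Γ₀(N), F) ≤ 2 dim_ℂ S₂(Γ₀(N))` over an ARBITRARY field `F` (any characteristic)

Topic `Literature/NumberTheory/ModularSymbols`; sequel to `ModularSymbolsParabolicCohomologyProofs`
(Shimura's count `dim_ℝ H¹_P(Γ₀(N), ℝ) = 2 dim_ℂ S₂(Γ₀(N))` by an explicit Shapiro lemma) and input of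
`PeriodHomologyGroupPresentationProofs` (the discharge of Knapp's Prop. 11.22,
`periodFunctional_ker_le_ellipticParabolic_sup_commutator`).

For a field `F` let `Z¹_EP(Γ₀(N), F)` (`epCocycles N F`) be the `F`-space of maps `u : Γ₀(N) → F` with
`u(γδ) = u(γ) + u(δ)` that vanish on every parabolic element (Mathlib `Matrix.IsParabolic`) and on
every elliptic element (`Matrix.IsElliptic`) of `Γ₀(N)`; equivalently `Hom(Γ₀(N)ᵃᵇ/Γ_epᵃᵇ, F)` with
Knapp's `Γ_ep` (`PeriodHomologyGroupPresentation`).  MAIN THEOREM (`finrank_epCocycles_le_two_mul_finrank`):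

  **`dim_F Z¹_EP(Γ₀(N), F) ≤ 2 dim_ℂ S₂(Γ₀(N))` for every field `F` and every `N ≥ 1`**,

in the sharper form `6 dim_F Z¹_EP + 3ε₂ + 4ε₃ + 6ε_∞ ≤ 12 + μ` (`six_mul_finrank_epCocycles_le`;
`μ = [SL(2, ℤ) : Γ₀(N)]`, `ε₂ = #{x ∈ X : Sx = x}`, `ε₃ = #{x : TSx = x}`, `ε_∞` = number of cusps,
`X = SL(2, ℤ)/Γ₀(N)`), combined with the tree's genus formula `12 dim S₂(Γ₀(N)) + 3ε₂ + 4ε₃ + 6ε_∞ = 12 + μ`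
(`twelve_mul_finrank_cuspForm_two_gamma0_holds`).

## Why a new count (characteristic `2` and `3`)

`ModularSymbolsParabolicCohomologyProofs` proves the same inequality over `ℝ` for homomorphisms killing
only the parabolic elements, by Shapiro's lemma made explicit (a homomorphism `u` gives the `1`-cocycle
`E_u(g)(x) = u(s(gx)⁻¹ g s(x))` of `SL(2, ℤ) = ⟨S, T⟩` in `F^X`, determined by `E(S)`, `E(ST)`) and the
ranks `2 rk(1 + S^*) = μ + ε₂`, `3 rk(1 + U + U²) = μ + 2ε₃` (`U = (ST)^*`), which divide by `2` and `3`
and FAIL over `𝔽₂`, `𝔽₃` (an `S`-fixed coset only gives `2E(S)(x) = 0`).  Here the vanishing of `u` on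
ELLIPTIC elements supplies exactly the missing equations: if `Sx = x` then `s(x)⁻¹ S s(x) ∈ Γ₀(N)` is a
conjugate of `S`, hence elliptic, so `E_u(S)(x) = 0` outright (`lift_S_apply_eq_zero`), and likewise
`E_u(ST)(x) = 0` when `STx = x` (`lift_ST_apply_eq_zero`).  The relation spaces are therefore replaced by
`K_S = {a : S^*a = -a, a|_{Fix S} = 0}` and `K_U = {b : b + Ub + U²b = 0, b|_{Fix ST} = 0}`, whose
dimensions are bounded over ANY field by transversal counting (no division in `F`):
`2 dim K_S + ε₂ ≤ μ` (`two_mul_finrank_kerS_add_le`: `a` is determined by its values on the half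
`R = {x : Sx ≠ x, rk x < rk Sx}` of the free `S`-orbits, and `#R ≤ #(S·R)` with `R ⊔ S·R = {Sx ≠ x}`) and
`3 dim K_U + 2ε₃ ≤ 2μ` (`three_mul_finrank_kerU_add_le`: `b` is determined by its values off the orbit
minima `R'` of the free `ST`-orbits, and `{STx ≠ x} ⊆ R' ∪ ST·R' ∪ (ST)²·R'`).  The rest of the count
(`cuspSum`, the codimension-`1` lemma, the Shapiro lift and its kernel) is the tree's argument verbatim
over `F`; the group-theoretic transfer elements `ParabolicCount.liftElem` etc. are reused.

Consequence used downstream: for every prime `ℓ`, `dim_{𝔽_ℓ} Hom(Γ₀(N)ᵃᵇ/Γ_epᵃᵇ, 𝔽_ℓ) ≤ 2g = rank` of the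
period lattice, which forces `Γ₀(N)ᵃᵇ/Γ_epᵃᵇ` to be torsion-free (`PeriodHomologyGroupPresentationProofs`).
Everything here is a THEOREM (no named fact, no instance, no notation, no `sorry`; the helpers are `private`);
nothing about any elliptic curve is asserted.

## References

* G. Shimura, *Introduction to the arithmetic theory of automorphic functions* (1971), §8.1 (8.1.1)–(8.1.4),
  Prop. 8.1–8.3; §8.2 (8.2.23)–(8.2.24) (the count `dim H¹_P(Γ, X) = 2g`, case `n = 0`). [ShimuraIATAF1971]
* K. S. Brown, *Cohomology of groups*, GTM 87 (1982), III.6 Prop. 6.2 (Shapiro's lemma). [Brown1982]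
* A. W. Knapp, *Elliptic Curves* (1993), Prop. 11.22 (`H₁(X₀(N), ℤ) ≅ Γ₀(N)ᵃᵇ/Γ_epᵃᵇ`). [Knapp1993]
* J. E. Cremona, *Algorithms for modular elliptic curves*, 2nd ed. (1997), §2.1–2.2. [CremonaAlgorithms1997]
-/

noncomputable section

open scoped MatrixGroups ModularForm

open CongruenceSubgroup Matrix.SpecialLinearGroup ModularGroup
open Literature.NumberTheory.EllipticCurves.ModularForms
open Literature.NumberTheory.EllipticCurves.ModularForms.ParabolicCount

namespace Literature.NumberTheory.ModularSymbols

/-! ### The space `Z¹_EP(Γ₀(N), F)` of homomorphisms killing parabolic and elliptic elements -/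

section EPCocycles

variable (N : ℕ) (F : Type*) [Field F]

/-- **`Z¹_EP(Γ₀(N), F)`**: the `F`-space of maps `u : Γ₀(N) → F` with `u(γδ) = u(γ) + u(δ)` vanishing on
every parabolic and on every elliptic element of `Γ₀(N)` — the `F`-dual of Knapp's `Γ₀(N)ᵃᵇ/Γ_epᵃᵇ`
(Shimura's `Z¹_P(Γ₀(N), F)` for trivial coefficients, (8.1.1)/(8.1.4), cut down by the elliptic
elements). [cite: Knapp1993, Prop. 11.22 (PDF p. 242)] [cite: ShimuraIATAF1971, §8.1 (8.1.1), (8.1.4)] -/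
def epCocycles : Submodule F (Gamma0 N → F) where
  carrier := {u | (∀ γ δ : Gamma0 N, u (γ * δ) = u γ + u δ) ∧
    (∀ γ : Gamma0 N, ((γ : SL(2, ℤ)) : Matrix (Fin 2) (Fin 2) ℤ).IsParabolic → u γ = 0) ∧
    ∀ γ : Gamma0 N, ((γ : SL(2, ℤ)) : Matrix (Fin 2) (Fin 2) ℤ).IsElliptic → u γ = 0}
  add_mem' := by
    rintro u v ⟨hu, hu', hu''⟩ ⟨hv, hv', hv''⟩
    refine ⟨fun γ δ ↦ ?_, fun γ hγ ↦ ?_, fun γ hγ ↦ ?_⟩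
    · simp only [Pi.add_apply, hu, hv]; ring
    · simp [hu' γ hγ, hv' γ hγ]
    · simp [hu'' γ hγ, hv'' γ hγ]
  zero_mem' := ⟨fun _ _ ↦ by simp, fun _ _ ↦ rfl, fun _ _ ↦ rfl⟩
  smul_mem' := by
    rintro c u ⟨hu, hu', hu''⟩
    refine ⟨fun γ δ ↦ ?_, fun γ hγ ↦ ?_, fun γ hγ ↦ ?_⟩
    · simp only [Pi.smul_apply, hu, smul_eq_mul]; ring
    · simp [hu' γ hγ]
    · simp [hu'' γ hγ]

variable {N F}

/-- Unfolding `epCocycles`: membership is the homomorphism property plus vanishing on the parabolic and on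
the elliptic elements (the generators of Knapp's `Γ_ep`). [cite: Knapp1993, Prop. 11.22 (PDF p. 242)] -/
theorem mem_epCocycles_iff {u : Gamma0 N → F} :
    u ∈ epCocycles N F ↔ (∀ γ δ : Gamma0 N, u (γ * δ) = u γ + u δ) ∧
      (∀ γ : Gamma0 N, ((γ : SL(2, ℤ)) : Matrix (Fin 2) (Fin 2) ℤ).IsParabolic → u γ = 0) ∧
      ∀ γ : Gamma0 N, ((γ : SL(2, ℤ)) : Matrix (Fin 2) (Fin 2) ℤ).IsElliptic → u γ = 0 :=
  Iff.rfl

/-- `u(1) = 0` for an additive `u : Γ₀(N) → F`. [folklore] -/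
private theorem map_one_of_additive {u : Gamma0 N → F} (hu : ∀ γ δ, u (γ * δ) = u γ + u δ) : u 1 = 0 := by
  have h := hu 1 1
  rw [mul_one] at h
  exact left_eq_add.mp h

/-- `u(γ⁻¹) = -u(γ)` for an additive `u : Γ₀(N) → F`. [folklore] -/
private theorem map_inv_of_additive {u : Gamma0 N → F} (hu : ∀ γ δ, u (γ * δ) = u γ + u δ) (γ : Gamma0 N) :
    u γ⁻¹ = -u γ := by
  have h := hu γ⁻¹ γ
  rw [inv_mul_cancel, map_one_of_additive hu] at h
  exact eq_neg_of_add_eq_zero_left h.symm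

/-- An additive `u : Γ₀(N) → F` is a class function: `u(δ⁻¹ γ δ) = u(γ)`. [folklore] -/
private theorem map_conj_of_additive {u : Gamma0 N → F} (hu : ∀ γ δ, u (γ * δ) = u γ + u δ) (γ δ : Gamma0 N) :
    u (δ⁻¹ * γ * δ) = u γ := by
  rw [hu, hu, map_inv_of_additive hu]
  ring

/-- A cocycle is a homomorphism `Γ₀(N) → F` (multiplicative packaging). [folklore] -/
def epHom (u : Gamma0 N → F) (hu : ∀ γ δ : Gamma0 N, u (γ * δ) = u γ + u δ) :
    Gamma0 N →* Multiplicative F where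
  toFun γ := Multiplicative.ofAdd (u γ)
  map_one' := by simp [map_one_of_additive hu]
  map_mul' γ δ := by rw [hu, ofAdd_add]

/-- Unfolding `epHom`. [folklore] -/
@[simp] private theorem epHom_apply (u : Gamma0 N → F) (hu : ∀ γ δ : Gamma0 N, u (γ * δ) = u γ + u δ)
    (γ : Gamma0 N) : epHom u hu γ = Multiplicative.ofAdd (u γ) := rfl

/-- An additive map is determined by its values on a generating set of `Γ₀(N)`. [folklore] -/
private theorem eq_of_eqOn_generators {S : Set (Gamma0 N)} (hS : Subgroup.closure S = ⊤) {u v : Gamma0 N → F}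
    (hu : ∀ γ δ, u (γ * δ) = u γ + u δ) (hv : ∀ γ δ, v (γ * δ) = v γ + v δ)
    (h : ∀ s ∈ S, u s = v s) : u = v := by
  have key : epHom u hu = epHom v hv := by
    refine MonoidHom.eq_of_eqOn_dense hS fun s hs ↦ ?_
    change Multiplicative.ofAdd (u s) = Multiplicative.ofAdd (v s)
    rw [h s hs]
  funext γ
  exact Multiplicative.ofAdd.injective (DFunLike.congr_fun key γ)

variable (N F) in
/-- **`Z¹_EP(Γ₀(N), F)` is finite-dimensional**: a cocycle is a homomorphism, determined by its values on
a finite generating set of `Γ₀(N)` (Mathlib: `Γ₀(N)` has finite index in the finitely generated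
`SL(2, ℤ)`); Shimura's Prop. 8.3 gives the exact dimension.  A theorem, not an instance.
[cite: ShimuraIATAF1971, §8.1 Prop. 8.3] -/
theorem finite_epCocycles [NeZero N] : Module.Finite F (epCocycles N F) := by
  obtain ⟨S, hS⟩ := Group.fg_def.mp (inferInstance : Group.FG (Gamma0 N))
  let e : epCocycles N F →ₗ[F] (S → F) :=
    { toFun := fun u s ↦ (u : Gamma0 N → F) s
      map_add' := fun _ _ ↦ rfl
      map_smul' := fun _ _ ↦ rfl }
  refine Module.Finite.of_injective e fun u v huv ↦ ?_
  apply Subtype.ext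
  exact eq_of_eqOn_generators hS u.2.1 v.2.1 fun s hs ↦ congr_fun huv ⟨s, hs⟩

end EPCocycles

namespace EPCount

open _root_.Module _root_.LinearMap
open scoped Classical

variable {F : Type*} [Field F] {N : ℕ}

/-! ### The permutation representation `F^X`, `X = SL(2, ℤ)/Γ₀(N)` -/

/-- The permutation action of `g ∈ SL(2, ℤ)` on `F^X`: `(g^* f)(x) = f(g x)`. [folklore] -/
def coperm (g : SL(2, ℤ)) : (Gamma0Coset N → F) →ₗ[F] (Gamma0Coset N → F) :=
  LinearMap.funLeft F F (g • ·)

/-- Unfolding `coperm`. [folklore] -/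
@[simp] private theorem coperm_apply (g : SL(2, ℤ)) (f : Gamma0Coset N → F) (x : Gamma0Coset N) :
    coperm g f x = f (g • x) := rfl

/-- `(gh)^* = h^* ∘ g^*`. [folklore] -/
private theorem coperm_mul (g h : SL(2, ℤ)) : coperm (F := F) (N := N) (g * h) = coperm h ∘ₗ coperm g := by
  apply LinearMap.ext
  intro f
  funext x
  simp [mul_smul]

/-- `1^* = 1`. [folklore] -/
private theorem coperm_one : coperm (F := F) (N := N) 1 = LinearMap.id := by
  apply LinearMap.ext
  intro f
  funext x
  simp

/-- `(-g)^* = g^*` (`-1 ∈ Γ₀(N)` acts trivially on the cosets). [folklore] -/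
private theorem coperm_neg (g : SL(2, ℤ)) : coperm (F := F) (N := N) (-g) = coperm g := by
  apply LinearMap.ext
  intro f
  funext x
  simp [neg_smul_coset]

/-- `(-1)^* = 1`. [folklore] -/
private theorem coperm_neg_one : coperm (F := F) (N := N) (-1) = LinearMap.id := by
  rw [coperm_neg, coperm_one]

/-- `g^* (g⁻¹)^* f = f`. [folklore] -/
@[simp] private theorem coperm_coperm_inv (g : SL(2, ℤ)) (f : Gamma0Coset N → F) :
    coperm g (coperm g⁻¹ f) = f := by
  funext x
  simp [smul_smul]

/-- `(g⁻¹)^* g^* f = f`. [folklore] -/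
@[simp] private theorem coperm_inv_coperm (g : SL(2, ℤ)) (f : Gamma0Coset N → F) :
    coperm g⁻¹ (coperm g f) = f := by
  funext x
  simp [smul_smul]

/-- `g^* e_x = e_{g⁻¹x}`. [folklore] -/
private theorem coperm_single (g : SL(2, ℤ)) (x : Gamma0Coset N) (a : F) :
    coperm g (Pi.single x a) = Pi.single (g⁻¹ • x) a := by
  funext y
  simp only [coperm_apply, Pi.single_apply, eq_inv_smul_iff]

/-- `S(Sx) = x` on cosets (`S² = -1` acts trivially). [folklore] -/
private theorem S_smul_S_smul (x : Gamma0Coset N) : S • S • x = x := by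
  rw [← mul_smul, S_mul_S_eq_neg_one, neg_one_smul_coset]

/-- `(ST)³x = x` on cosets. [folklore] -/
private theorem ST_smul_ST_smul_ST_smul (x : Gamma0Coset N) : (S * T) • (S * T) • (S * T) • x = x := by
  rw [← mul_smul, ← mul_smul, ParabolicCount.ST_pow_three_eq, neg_one_smul_coset]

/-- `((ST)^*)³ = 1`. [folklore] -/
private theorem coperm_ST_comp_ST_comp_ST :
    coperm (F := F) (N := N) (S * T) ∘ₗ (coperm (S * T) ∘ₗ coperm (S * T)) = LinearMap.id := by
  rw [← coperm_mul, ← coperm_mul, ParabolicCount.ST_pow_three_eq, coperm_neg_one]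

/-! ### A numbering of the cosets (to choose transversals of the free `S`- and `ST`-orbits) -/

variable [NeZero N]

/-- A numbering `X ≃ Fin μ` of the cosets (any will do). [folklore] -/
def rk (x : Gamma0Coset N) : ℕ := (Fintype.equivFin (Gamma0Coset N) x : ℕ)

/-- Distinct cosets have distinct numbers. [folklore] -/
private theorem rk_ne_of_ne {x y : Gamma0Coset N} (h : x ≠ y) : rk x ≠ rk y :=
  fun e ↦ h ((Fintype.equivFin (Gamma0Coset N)).injective (Fin.ext e))

/-! ### The refined `S`-relation space `K_S = {a : S^*a = -a, a|_{Fix S} = 0}` and `2 dim K_S + ε₂ ≤ μ` -/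

variable (F N) in
/-- `K_S = {a ∈ F^X : a(Sx) = -a(x) for all x, a(x) = 0 whenever Sx = x}`. [folklore] -/
def kerS : Submodule F (Gamma0Coset N → F) where
  carrier := {a | (∀ x, a (S • x) = -a x) ∧ ∀ x, S • x = x → a x = 0}
  add_mem' := by
    rintro a b ⟨ha, ha'⟩ ⟨hb, hb'⟩
    refine ⟨fun x ↦ ?_, fun x hx ↦ ?_⟩
    · simp only [Pi.add_apply, ha, hb]; ring
    · simp [ha' x hx, hb' x hx]
  zero_mem' := ⟨fun _ ↦ by simp, fun _ _ ↦ rfl⟩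
  smul_mem' := by
    rintro c a ⟨ha, ha'⟩
    refine ⟨fun x ↦ ?_, fun x hx ↦ ?_⟩
    · simp only [Pi.smul_apply, ha, smul_eq_mul]; ring
    · simp [ha' x hx]

omit [NeZero N] in
/-- Membership in `K_S`. [folklore] -/
private theorem mem_kerS_iff {a : Gamma0Coset N → F} :
    a ∈ kerS F N ↔ (∀ x, a (S • x) = -a x) ∧ ∀ x, S • x = x → a x = 0 := Iff.rfl

/-- The chosen half `R = {x : Sx ≠ x, rk x < rk Sx}` of the free `S`-orbits. [folklore] -/
def halfS : Finset (Gamma0Coset N) :=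
  Finset.univ.filter fun x ↦ S • x ≠ x ∧ rk x < rk (S • x)

/-- The other half `R' = {x : Sx ≠ x, rk Sx < rk x}` of the free `S`-orbits. [folklore] -/
def halfS' : Finset (Gamma0Coset N) :=
  Finset.univ.filter fun x ↦ S • x ≠ x ∧ rk (S • x) < rk x

/-- Membership in `R`. [folklore] -/
private theorem mem_halfS {x : Gamma0Coset N} : x ∈ halfS (N := N) ↔ S • x ≠ x ∧ rk x < rk (S • x) := by
  simp [halfS]

/-- Membership in `R'`. [folklore] -/
private theorem mem_halfS' {x : Gamma0Coset N} : x ∈ halfS' (N := N) ↔ S • x ≠ x ∧ rk (S • x) < rk x := by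
  simp [halfS']

/-- `#R + #R' + ε₂ = μ`: every coset is `S`-fixed or lies in exactly one half. [folklore] -/
private theorem card_halfS_add :
    (halfS (N := N)).card + (halfS' (N := N)).card +
        (Finset.univ.filter fun x : Gamma0Coset N ↦ S • x = x).card =
      Fintype.card (Gamma0Coset N) := by
  have hdisj1 : Disjoint (halfS (N := N)) halfS' := by
    rw [Finset.disjoint_left]
    intro x h1 h2
    exact lt_asymm (mem_halfS.mp h1).2 (mem_halfS'.mp h2).2
  have hdisj2 : Disjoint (halfS (N := N) ∪ halfS') (Finset.univ.filter fun x ↦ S • x = x) := by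
    rw [Finset.disjoint_left]
    intro x hx hfix
    rw [Finset.mem_filter] at hfix
    rcases Finset.mem_union.mp hx with h | h
    · exact (mem_halfS.mp h).1 hfix.2
    · exact (mem_halfS'.mp h).1 hfix.2
  have hunion : halfS (N := N) ∪ halfS' ∪ (Finset.univ.filter fun x ↦ S • x = x) = Finset.univ := by
    ext x
    simp only [Finset.mem_union, Finset.mem_filter, Finset.mem_univ, true_and, iff_true, mem_halfS,
      mem_halfS']
    by_cases hx : S • x = x
    · exact Or.inr hx
    · rcases lt_or_gt_of_ne (rk_ne_of_ne (N := N) (Ne.symm hx)) with h | h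
      · exact Or.inl (Or.inl ⟨hx, h⟩)
      · exact Or.inl (Or.inr ⟨hx, h⟩)
  rw [← Finset.card_union_of_disjoint hdisj1, ← Finset.card_union_of_disjoint hdisj2, hunion,
    Finset.card_univ]

/-- `#R ≤ #R'`: `x ↦ Sx` maps the first half injectively into the second. [folklore] -/
private theorem card_halfS_le_card_halfS' : (halfS (N := N)).card ≤ (halfS' (N := N)).card := by
  refine Finset.card_le_card_of_injOn (fun x ↦ S • x) (fun x hx ↦ ?_) (fun x _ y _ h ↦ ?_)
  · rw [Finset.mem_coe, mem_halfS] at hx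
    rw [Finset.mem_coe, mem_halfS', S_smul_S_smul]
    exact ⟨fun h ↦ hx.1 h.symm, hx.2⟩
  · simpa [S_smul_S_smul] using congrArg (fun z ↦ S • z) h

/-- **`2 dim K_S + ε₂ ≤ μ`**: an element of `K_S` is determined by its values on the half `R` of the free
`S`-orbits (`a(Sx) = -a(x)`, `a = 0` on the fixed cosets), and `2#R ≤ #R + #R' = μ - ε₂`. [folklore] -/
private theorem two_mul_finrank_kerS_add_le :
    2 * finrank F (kerS F N) + (Finset.univ.filter fun x : Gamma0Coset N ↦ S • x = x).card ≤
      Fintype.card (Gamma0Coset N) := by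
  let res : kerS F N →ₗ[F] (halfS (N := N) → F) :=
    { toFun := fun a r ↦ (a : Gamma0Coset N → F) r
      map_add' := fun _ _ ↦ rfl
      map_smul' := fun _ _ ↦ rfl }
  have hinj : Function.Injective res := by
    intro a b hab
    apply Subtype.ext
    funext x
    obtain ⟨ha, ha'⟩ := mem_kerS_iff.mp a.2
    obtain ⟨hb, hb'⟩ := mem_kerS_iff.mp b.2
    have hres : ∀ r ∈ halfS (N := N), (a : Gamma0Coset N → F) r = (b : Gamma0Coset N → F) r :=
      fun r hr ↦ congr_fun hab ⟨r, hr⟩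
    by_cases hx : S • x = x
    · rw [ha' x hx, hb' x hx]
    · rcases lt_or_gt_of_ne (rk_ne_of_ne (N := N) (Ne.symm hx)) with h | h
      · exact hres x (mem_halfS.mpr ⟨hx, h⟩)
      · -- `Sx ∈ R` and `a(Sx) = -a(x)`
        have hmem : S • x ∈ halfS (N := N) := by
          rw [mem_halfS, S_smul_S_smul]
          exact ⟨fun h' ↦ hx h'.symm, h⟩
        have h1 := hres _ hmem
        rw [ha, hb] at h1
        exact neg_injective h1
  have h1 := LinearMap.finrank_le_finrank_of_injective hinj
  rw [finrank_fintype_fun_eq_card, Fintype.card_coe] at h1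
  have h2 := card_halfS_add (N := N)
  have h3 := card_halfS_le_card_halfS' (N := N)
  omega

/-! ### The refined `ST`-relation space `K_U = {b : b + Ub + U²b = 0, b|_{Fix ST} = 0}` and `3 dim K_U + 2ε₃ ≤ 2μ` -/

variable (F N) in
/-- `K_U = {b ∈ F^X : b(x) + b(STx) + b((ST)²x) = 0 for all x, b(x) = 0 whenever STx = x}`. [folklore] -/
def kerU : Submodule F (Gamma0Coset N → F) where
  carrier := {b | (∀ x, b x + b ((S * T) • x) + b ((S * T) • (S * T) • x) = 0) ∧
    ∀ x, (S * T) • x = x → b x = 0}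
  add_mem' := by
    rintro a b ⟨ha, ha'⟩ ⟨hb, hb'⟩
    refine ⟨fun x ↦ ?_, fun x hx ↦ ?_⟩
    · simp only [Pi.add_apply]
      linear_combination ha x + hb x
    · simp [ha' x hx, hb' x hx]
  zero_mem' := ⟨fun _ ↦ by simp, fun _ _ ↦ rfl⟩
  smul_mem' := by
    rintro c a ⟨ha, ha'⟩
    refine ⟨fun x ↦ ?_, fun x hx ↦ ?_⟩
    · simp only [Pi.smul_apply, smul_eq_mul]
      linear_combination c * ha x
    · simp [ha' x hx]

omit [NeZero N] in
/-- Membership in `K_U`. [folklore] -/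
private theorem mem_kerU_iff {b : Gamma0Coset N → F} :
    b ∈ kerU F N ↔ (∀ x, b x + b ((S * T) • x) + b ((S * T) • (S * T) • x) = 0) ∧
      ∀ x, (S * T) • x = x → b x = 0 := Iff.rfl

omit [NeZero N] in
/-- On a free `ST`-orbit the three points `x`, `STx`, `(ST)²x` are pairwise distinct. [folklore] -/
private theorem ST_orbit_distinct {x : Gamma0Coset N} (hx : (S * T) • x ≠ x) :
    (S * T) • (S * T) • x ≠ x ∧ (S * T) • (S * T) • x ≠ (S * T) • x := by
  refine ⟨fun h ↦ hx ((ST_smul_iff x).mp h), fun h ↦ ?_⟩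
  -- `ST` fixes `STx`, hence fixes `x = (ST)²(STx)`
  have h2 : (S * T) • (S * T) • ((S * T) • x) = (S * T) • x := by rw [h, h]
  have h3 := ST_smul_ST_smul_ST_smul (N := N) x
  rw [h2] at h3
  exact hx h3

/-- The orbit minima `R' = {x : STx ≠ x, rk x < rk STx, rk x < rk (ST)²x}` of the free `ST`-orbits. [folklore] -/
def minU : Finset (Gamma0Coset N) :=
  Finset.univ.filter fun x ↦ (S * T) • x ≠ x ∧ rk x < rk ((S * T) • x) ∧ rk x < rk ((S * T) • (S * T) • x)

/-- The free non-minimal cosets `{x : STx ≠ x} ∖ R'`. [folklore] -/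
def restU : Finset (Gamma0Coset N) :=
  Finset.univ.filter fun x ↦ (S * T) • x ≠ x ∧ ¬ (rk x < rk ((S * T) • x) ∧ rk x < rk ((S * T) • (S * T) • x))

/-- Membership in `R'`. [folklore] -/
private theorem mem_minU {x : Gamma0Coset N} : x ∈ minU (N := N) ↔
    (S * T) • x ≠ x ∧ rk x < rk ((S * T) • x) ∧ rk x < rk ((S * T) • (S * T) • x) := by
  simp [minU]

/-- Membership in the free non-minimal cosets. [folklore] -/
private theorem mem_restU {x : Gamma0Coset N} : x ∈ restU (N := N) ↔
    (S * T) • x ≠ x ∧ ¬ (rk x < rk ((S * T) • x) ∧ rk x < rk ((S * T) • (S * T) • x)) := by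
  simp [restU]

/-- `R'` and the free non-minimal cosets are disjoint. [folklore] -/
private theorem disjoint_minU_restU : Disjoint (minU (N := N)) restU := by
  rw [Finset.disjoint_left]
  intro x h1 h2
  exact (mem_restU.mp h2).2 (mem_minU.mp h1).2

/-- `#R' + #rest + ε₃ = μ`. [folklore] -/
private theorem card_minU_add :
    (minU (N := N)).card + (restU (N := N)).card +
        (Finset.univ.filter fun x : Gamma0Coset N ↦ (S * T) • x = x).card =
      Fintype.card (Gamma0Coset N) := by
  have hdisj2 : Disjoint (minU (N := N) ∪ restU) (Finset.univ.filter fun x ↦ (S * T) • x = x) := by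
    rw [Finset.disjoint_left]
    intro x hx hfix
    rw [Finset.mem_filter] at hfix
    rcases Finset.mem_union.mp hx with h | h
    · exact (mem_minU.mp h).1 hfix.2
    · exact (mem_restU.mp h).1 hfix.2
  have hunion : minU (N := N) ∪ restU ∪ (Finset.univ.filter fun x ↦ (S * T) • x = x) = Finset.univ := by
    ext x
    simp only [Finset.mem_union, Finset.mem_filter, Finset.mem_univ, true_and, iff_true, mem_minU,
      mem_restU]
    by_cases hx : (S * T) • x = x
    · exact Or.inr hx
    · by_cases h : rk x < rk ((S * T) • x) ∧ rk x < rk ((S * T) • (S * T) • x)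
      · exact Or.inl (Or.inl ⟨hx, h⟩)
      · exact Or.inl (Or.inr ⟨hx, h⟩)
  rw [← Finset.card_union_of_disjoint disjoint_minU_restU, ← Finset.card_union_of_disjoint hdisj2,
    hunion, Finset.card_univ]

/-- Every free coset is `x`, `STx` or `(ST)²x` for an orbit minimum `x ∈ R'`, so
`μ - ε₃ ≤ 3#R'`. [folklore] -/
private theorem card_free_le_three_mul_card_minU :
    (minU (N := N)).card + (restU (N := N)).card ≤ 3 * (minU (N := N)).card := by
  rw [← Finset.card_union_of_disjoint disjoint_minU_restU]
  let u : Gamma0Coset N → Gamma0Coset N := fun x ↦ (S * T) • x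
  have hcover : minU (N := N) ∪ restU ⊆ minU ∪ (minU.image u ∪ minU.image (u ∘ u)) := by
    intro x hx
    have hfree : (S * T) • x ≠ x := by
      rcases Finset.mem_union.mp hx with h | h
      · exact (mem_minU.mp h).1
      · exact (mem_restU.mp h).1
    obtain ⟨h2, h12⟩ := ST_orbit_distinct hfree
    have h3 := ST_smul_ST_smul_ST_smul (N := N) x
    -- the three numbers `rk x`, `rk STx`, `rk (ST)²x` are pairwise distinct
    have n01 : rk x ≠ rk ((S * T) • x) := rk_ne_of_ne (Ne.symm hfree)
    have n02 : rk x ≠ rk ((S * T) • (S * T) • x) := rk_ne_of_ne (Ne.symm h2)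
    have n12 : rk ((S * T) • x) ≠ rk ((S * T) • (S * T) • x) := rk_ne_of_ne (Ne.symm h12)
    simp only [Finset.mem_union, Finset.mem_image, Function.comp_apply, mem_minU]
    by_cases hA : rk x < rk ((S * T) • x) ∧ rk x < rk ((S * T) • (S * T) • x)
    · exact Or.inl ⟨hfree, hA⟩
    · right
      by_cases hB : rk ((S * T) • x) < rk ((S * T) • (S * T) • x)
      · -- the minimum is `STx`, and `x = (ST)²(STx)`
        right
        have h10 : rk ((S * T) • x) < rk x := by
          rcases lt_or_gt_of_ne n01 with h | h
          · exact absurd ⟨h, h.trans hB⟩ hA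
          · exact h
        refine ⟨(S * T) • x, ⟨h12, hB, ?_⟩, h3⟩
        rw [h3]
        exact h10
      · -- the minimum is `(ST)²x`, and `x = ST((ST)²x)`
        left
        have h21 : rk ((S * T) • (S * T) • x) < rk ((S * T) • x) :=
          (lt_or_gt_of_ne n12).resolve_left hB
        have h20 : rk ((S * T) • (S * T) • x) < rk x := by
          rcases lt_or_gt_of_ne n02 with h | h
          · exact absurd ⟨h.trans h21, h⟩ hA
          · exact h
        refine ⟨(S * T) • (S * T) • x, ⟨?_, ?_, ?_⟩, h3⟩
        · rw [h3]
          exact Ne.symm h2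
        · rw [h3]
          exact h20
        · rw [h3]
          exact h21
  have hcard := Finset.card_le_card hcover
  have hu1 : (minU.image u).card ≤ (minU (N := N)).card := Finset.card_image_le
  have hu2 : (minU.image (u ∘ u)).card ≤ (minU (N := N)).card := Finset.card_image_le
  have hun := Finset.card_union_le (minU (N := N)) (minU.image u ∪ minU.image (u ∘ u))
  have hun' := Finset.card_union_le (minU.image u) ((minU (N := N)).image (u ∘ u))
  omega

/-- **`3 dim K_U + 2ε₃ ≤ 2μ`**: an element of `K_U` is determined by its values on the free non-minimal
cosets (`b(x) = -b(STx) - b((ST)²x)` at an orbit minimum, `b = 0` on the fixed cosets), and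
`3 #rest = 3(μ - ε₃) - 3#R' ≤ 2(μ - ε₃)`. [folklore] -/
private theorem three_mul_finrank_kerU_add_le :
    3 * finrank F (kerU F N) + 2 * (Finset.univ.filter fun x : Gamma0Coset N ↦ (S * T) • x = x).card ≤
      2 * Fintype.card (Gamma0Coset N) := by
  let res : kerU F N →ₗ[F] (restU (N := N) → F) :=
    { toFun := fun b r ↦ (b : Gamma0Coset N → F) r
      map_add' := fun _ _ ↦ rfl
      map_smul' := fun _ _ ↦ rfl }
  have hinj : Function.Injective res := by
    intro a b hab
    apply Subtype.ext
    obtain ⟨ha, ha'⟩ := mem_kerU_iff.mp a.2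
    obtain ⟨hb, hb'⟩ := mem_kerU_iff.mp b.2
    have hres : ∀ r ∈ restU (N := N), (a : Gamma0Coset N → F) r = (b : Gamma0Coset N → F) r :=
      fun r hr ↦ congr_fun hab ⟨r, hr⟩
    -- agreement off the minima
    have hoff : ∀ x, x ∉ minU (N := N) → (a : Gamma0Coset N → F) x = (b : Gamma0Coset N → F) x := by
      intro x hx
      by_cases hfix : (S * T) • x = x
      · rw [ha' x hfix, hb' x hfix]
      · exact hres x (mem_restU.mpr ⟨hfix, fun h ↦ hx (mem_minU.mpr ⟨hfix, h⟩)⟩)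
    funext x
    by_cases hx : x ∈ minU (N := N)
    · obtain ⟨hfree, h1, h2⟩ := mem_minU.mp hx
      have h3 := ST_smul_ST_smul_ST_smul (N := N) x
      -- `STx` and `(ST)²x` are not minima
      have hn1 : (S * T) • x ∉ minU (N := N) := by
        intro h
        obtain ⟨-, -, h'⟩ := mem_minU.mp h
        rw [h3] at h'
        exact lt_asymm h1 h'
      have hn2 : (S * T) • (S * T) • x ∉ minU (N := N) := by
        intro h
        obtain ⟨-, h', -⟩ := mem_minU.mp h
        rw [h3] at h'
        exact lt_asymm h2 h'
      have ea := ha x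
      have eb := hb x
      rw [hoff _ hn1, hoff _ hn2] at ea
      linear_combination ea - eb
    · exact hoff x hx
  have h1 := LinearMap.finrank_le_finrank_of_injective hinj
  rw [finrank_fintype_fun_eq_card, Fintype.card_coe] at h1
  have h2 := card_minU_add (N := N)
  have h3 := card_free_le_three_mul_card_minU (N := N)
  omega

/-! ### The cusp sums `b ↦ (∑_{x ∈ orbit} b(x))_{orbits of T}` -/

variable (F N) in
/-- The **cusp-sum map** `F^X → F^{cusps}`: `b ↦ (∑_{y ∈ ⟨T⟩x} b(y))_x`, indexed by the base points `x` of
the `⟨T⟩`-orbits on `X = SL(2, ℤ)/Γ₀(N)` (one per cusp, `card_basePoints`). [folklore] -/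
def cuspSum : (Gamma0Coset N → F) →ₗ[F] ({x // x ∈ basePoints N} → F) where
  toFun b p := ∑ y ∈ orbitFin N p.1, b y
  map_add' b b' := by
    funext p
    simp [Finset.sum_add_distrib]
  map_smul' c b := by
    funext p
    simp [Finset.mul_sum]

/-- Unfolding `cuspSum`. [folklore] -/
@[simp] private theorem cuspSum_apply (b : Gamma0Coset N → F) (p : {x // x ∈ basePoints N}) :
    cuspSum F N b p = ∑ y ∈ orbitFin N p.1, b y := rfl

/-- The cusp sums are `T^*`-invariant. [folklore] -/
private theorem cuspSum_coperm_T (b : Gamma0Coset N → F) : cuspSum F N (coperm T b) = cuspSum F N b := by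
  funext p
  obtain ⟨p, hp⟩ := p
  simp only [cuspSum_apply, coperm_apply]
  rw [sum_orbitFin_eq, sum_orbitFin_eq]
  simp_rw [smul_smul, ← pow_succ']
  have h := Finset.sum_range_succ' (fun i ↦ b (T ^ i • p)) (width N p)
  have h' := Finset.sum_range_succ (fun i ↦ b (T ^ i • p)) (width N p)
  rw [T_pow_width_smul] at h'
  simp only [pow_zero, one_smul] at h
  rw [h'] at h
  exact (add_right_cancel h).symm

/-- The cusp-sum map is onto `F^{cusps}`. [folklore] -/
private theorem cuspSum_surjective : Function.Surjective (cuspSum F N) := by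
  intro h
  refine ⟨fun x ↦ if hx : x ∈ basePoints N then h ⟨x, hx⟩ else 0, ?_⟩
  funext p
  obtain ⟨p, hp⟩ := p
  rw [cuspSum_apply, Finset.sum_eq_single p]
  · simp [hp]
  · intro y hy hyp
    rw [dif_neg]
    intro hyb
    have h1 : base N y = base N p := base_eq_of_mem N hy
    rw [(Finset.mem_filter.mp hyb).2, (Finset.mem_filter.mp hp).2] at h1
    exact hyp h1
  · intro hnp
    exact absurd (self_mem_orbitFin N p) hnp

/-- `rank(cusp sums) = ν_∞`. [folklore] -/
private theorem finrank_range_cuspSum : finrank F (range (cuspSum F N)) = (basePoints N).card := by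
  rw [LinearMap.range_eq_top.mpr cuspSum_surjective, finrank_top, finrank_fintype_fun_eq_card,
    Fintype.card_coe]

/-- **`K_U + ker(cusp sums)` has codimension `≤ 1`**: it contains `Pf - f` for `P = (ST)^*` (as
`(1 + P + P²)(P - 1) = P³ - 1 = 0` and `Pf - f` vanishes on the `ST`-fixed cosets) and for `P = T^*`,
hence for `P = g^*`, all `g ∈ ⟨ST, T⟩ = SL(2, ℤ)`, hence every `e_y - e_x` (`SL(2, ℤ)` is transitive on
`X`). [folklore] -/
private theorem card_le_finrank_kerU_sup_add_one :
    Fintype.card (Gamma0Coset N) ≤ finrank F ↥(kerU F N ⊔ LinearMap.ker (cuspSum F N)) + 1 := by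
  set R : Submodule F (Gamma0Coset N → F) := kerU F N ⊔ LinearMap.ker (cuspSum F N) with hR
  have hST : ∀ f : Gamma0Coset N → F, coperm (S * T) f - f ∈ R := fun f ↦ by
    refine Submodule.mem_sup_left ?_
    rw [mem_kerU_iff]
    refine ⟨fun x ↦ ?_, fun x hx ↦ ?_⟩
    · simp only [Pi.sub_apply, coperm_apply, ST_smul_ST_smul_ST_smul]
      ring
    · simp [hx]
  have hT : ∀ f : Gamma0Coset N → F, coperm T f - f ∈ R := fun f ↦ by
    refine Submodule.mem_sup_right ?_
    rw [LinearMap.mem_ker, map_sub, cuspSum_coperm_T, sub_self]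
  -- the subgroup of `g` with `g^* f - f ∈ R` for all `f`
  let K : Subgroup SL(2, ℤ) :=
    { carrier := {g | ∀ f : Gamma0Coset N → F, coperm g f - f ∈ R}
      mul_mem' := fun {a b} ha hb f ↦ by
        rw [coperm_mul, LinearMap.comp_apply, ← sub_add_sub_cancel _ (coperm a f) f]
        exact R.add_mem (hb _) (ha f)
      one_mem' := fun f ↦ by simp [coperm_one]
      inv_mem' := fun {a} ha f ↦ by
        have h := R.neg_mem (ha (coperm a⁻¹ f))
        rwa [coperm_coperm_inv, neg_sub] at h }
  have hTK : T ∈ K := hT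
  have hSK : S ∈ K := by
    have : S = S * T * T⁻¹ := by group
    rw [this]
    exact K.mul_mem hST (K.inv_mem hTK)
  have hK : K = ⊤ := by
    rw [eq_top_iff, ← SpecialLinearGroup.SL2Z_generators, Subgroup.closure_le]
    intro g hg
    rcases hg with rfl | rfl
    · exact hSK
    · exact hTK
  have hsingle : ∀ x y : Gamma0Coset N, Pi.single y (1 : F) - Pi.single x 1 ∈ R := by
    intro x y
    obtain ⟨g, hg⟩ : ∃ g : SL(2, ℤ), g⁻¹ • x = y := by
      induction x using QuotientGroup.induction_on with
      | H a =>
        induction y using QuotientGroup.induction_on with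
        | H b =>
          refine ⟨a * b⁻¹, ?_⟩
          rw [MulAction.Quotient.smul_mk, smul_eq_mul, mul_inv_rev, inv_inv, mul_assoc,
            inv_mul_cancel, mul_one]
    have h := (hK ▸ Subgroup.mem_top g : g ∈ K) (Pi.single x 1)
    rwa [coperm_single, hg] at h
  set x₀ : Gamma0Coset N := ((1 : SL(2, ℤ)) : Gamma0Coset N)
  set L : Submodule F (Gamma0Coset N → F) := Submodule.span F {Pi.single x₀ 1}
  have htop : (⊤ : Submodule F (Gamma0Coset N → F)) ≤ R ⊔ L := by
    rw [← (Pi.basisFun F _).span_eq, Submodule.span_le]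
    rintro _ ⟨x, rfl⟩
    rw [Pi.basisFun_apply]
    have : (Pi.single x (1 : F) : Gamma0Coset N → F) =
        (Pi.single x 1 - Pi.single x₀ 1) + Pi.single x₀ 1 := by abel
    rw [this]
    exact Submodule.add_mem_sup (hsingle x₀ x) (Submodule.subset_span rfl)
  have h1 : finrank F L ≤ 1 := by
    simpa using finrank_span_le_card ({Pi.single x₀ (1 : F)} : Set (Gamma0Coset N → F))
  have h2 := Submodule.finrank_mono htop
  rw [finrank_top, finrank_fintype_fun_eq_card] at h2
  have h3 := Submodule.finrank_add_le_finrank_add_finrank R L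
  omega

/-! ### Shapiro's lemma made explicit over `F` (the transfer elements `liftElem` are the tree's) -/

omit [NeZero N] in
/-- `-1 = (-T)·T⁻¹` with `T`, `-T ∈ Γ₀(N)` parabolic: **a cocycle kills `-1`** (in every characteristic;
`2u(-1) = 0` would not suffice). [folklore] -/
private theorem map_neg_one_eq_zero (u : epCocycles N F) (γ : Gamma0 N) (hγ : (γ : SL(2, ℤ)) = -1) :
    (u : Gamma0 N → F) γ = 0 := by
  obtain ⟨hu, hpar, -⟩ := mem_epCocycles_iff.mp u.2
  let t : Gamma0 N := ⟨T, by simp [Gamma0_mem, coe_T]⟩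
  let t' : Gamma0 N := ⟨-T, by simp [Gamma0_mem, coe_T]⟩
  have hT : ((t : SL(2, ℤ)) : Matrix (Fin 2) (Fin 2) ℤ).IsParabolic := by
    change ((T : SL(2, ℤ)) : Matrix (Fin 2) (Fin 2) ℤ).IsParabolic
    have := isParabolic_T_pow one_ne_zero
    rwa [pow_one] at this
  have hT' : ((t' : SL(2, ℤ)) : Matrix (Fin 2) (Fin 2) ℤ).IsParabolic := by
    change ((-T : SL(2, ℤ)) : Matrix (Fin 2) (Fin 2) ℤ).IsParabolic
    rw [Matrix.SpecialLinearGroup.coe_neg]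
    exact hT.neg
  have hγ' : γ = t' * t⁻¹ := Subtype.ext (by simp [t, t', hγ])
  rw [hγ', hu, map_inv_of_additive hu, hpar t hT, hpar t' hT']
  ring

/-- The **Shapiro lift** `E_u(g) = (x ↦ u(s(gx)⁻¹ g s(x))) ∈ F^X` of `u : Γ₀(N) → F` at `g ∈ SL(2, ℤ)`
(Brown III.6: the explicit inverse of `H¹(SL(2, ℤ), Coind F) ≅ H¹(Γ₀(N), F)` on cocycles).
[cite: ShimuraIATAF1971, §8.1 Prop. 8.1] -/
def lift (u : Gamma0 N → F) (g : SL(2, ℤ)) : Gamma0Coset N → F := fun x ↦ u (liftElem g x)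

omit [Field F] [NeZero N] in
/-- Unfolding `lift`. [folklore] -/
@[simp] private theorem lift_apply (u : Gamma0 N → F) (g : SL(2, ℤ)) (x : Gamma0Coset N) :
    lift u g x = u (liftElem g x) := rfl

/-- The coboundary `δf(g) = g^* f - f` of `f ∈ F^X`. [folklore] -/
def cobd (f : Gamma0Coset N → F) (g : SL(2, ℤ)) : Gamma0Coset N → F := coperm g f - f

omit [NeZero N] in
/-- Coboundaries are cocycles: `δf(gh) = h^* δf(g) + δf(h)`. [folklore] -/
private theorem cobd_mul (f : Gamma0Coset N → F) (g h : SL(2, ℤ)) :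
    cobd f (g * h) = coperm h (cobd f g) + cobd f h := by
  simp only [cobd, coperm_mul, LinearMap.comp_apply, map_sub]
  abel

omit [NeZero N] in
/-- `δf(1) = 0`. [folklore] -/
private theorem cobd_one (f : Gamma0Coset N → F) : cobd f 1 = 0 := by
  simp [cobd, coperm_one]

omit [NeZero N] in
/-- Coboundaries restrict to zero on `Γ₀(N)`: `δf(γ)(Γ₀(N)) = 0`. [folklore] -/
private theorem cobd_apply_coe_one (f : Gamma0Coset N → F) (γ : Gamma0 N) :
    cobd f γ ((1 : SL(2, ℤ)) : Gamma0Coset N) = 0 := by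
  simp [cobd, smul_coe_one_of_mem γ.2]

omit [NeZero N] in
/-- `δf(g)(x) = 0` when `gx = x`. [folklore] -/
private theorem cobd_apply_eq_zero_of_smul_eq (f : Gamma0Coset N → F) {g : SL(2, ℤ)} {x : Gamma0Coset N}
    (hx : g • x = x) : cobd f g x = 0 := by
  simp [cobd, hx]

/-- The cocycle `E_u + δf`. [folklore] -/
def tot (u : Gamma0 N → F) (f : Gamma0Coset N → F) (g : SL(2, ℤ)) : Gamma0Coset N → F :=
  lift u g + cobd f g

section Additive

variable {u : Gamma0 N → F} (hu : ∀ γ δ, u (γ * δ) = u γ + u δ)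
include hu

omit [NeZero N] in
/-- **The Shapiro lift of a homomorphism is a cocycle**: `E(gh) = h^* E(g) + E(h)`. [folklore] -/
private theorem lift_mul (g h : SL(2, ℤ)) : lift u (g * h) = coperm h (lift u g) + lift u h := by
  funext x
  simp only [lift_apply, Pi.add_apply, coperm_apply, liftElem_mul, hu]

omit [NeZero N] in
/-- `E(1) = 0`. [folklore] -/
private theorem lift_one : lift u 1 = 0 := by
  funext x
  simp [liftElem_one, map_one_of_additive hu]

omit [NeZero N] in
/-- **The lift restricts to `u` on `Γ₀(N)`**: `E_u(γ)(Γ₀(N)) = u(s₀⁻¹γs₀) = u(γ)`. [folklore] -/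
private theorem lift_apply_coe_one (γ : Gamma0 N) : lift u γ ((1 : SL(2, ℤ)) : Gamma0Coset N) = u γ := by
  have h1 : liftElem (γ : SL(2, ℤ)) ((1 : SL(2, ℤ)) : Gamma0Coset N) =
      (⟨sec ((1 : SL(2, ℤ)) : Gamma0Coset N), sec_one_mem⟩ : Gamma0 N)⁻¹ * γ *
        ⟨sec ((1 : SL(2, ℤ)) : Gamma0Coset N), sec_one_mem⟩ :=
    Subtype.ext (by simp [smul_coe_one_of_mem γ.2])
  rw [lift_apply, h1, map_conj_of_additive hu]

omit [NeZero N] in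
/-- `(E_u + δf)(gh) = h^*(E_u + δf)(g) + (E_u + δf)(h)`. [folklore] -/
private theorem tot_mul (f : Gamma0Coset N → F) (g h : SL(2, ℤ)) :
    tot u f (g * h) = coperm h (tot u f g) + tot u f h := by
  simp only [tot, lift_mul hu, cobd_mul, map_add]
  abel

omit [NeZero N] in
/-- `(E_u + δf)(1) = 0`. [folklore] -/
private theorem tot_one (f : Gamma0Coset N → F) : tot u f 1 = 0 := by
  simp [tot, lift_one hu, cobd_one]

omit [NeZero N] in
/-- `(E_u + δf)(g⁻¹) = -(g⁻¹)^*(E_u + δf)(g)`. [folklore] -/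
private theorem tot_inv (f : Gamma0Coset N → F) (g : SL(2, ℤ)) :
    tot u f g⁻¹ = -coperm g⁻¹ (tot u f g) := by
  have h := tot_mul hu f g g⁻¹
  rw [mul_inv_cancel, tot_one hu] at h
  exact eq_neg_of_add_eq_zero_right h.symm

omit [NeZero N] in
/-- `(E_u + δf)(γ)(Γ₀(N)) = u(γ)` for `γ ∈ Γ₀(N)`. [folklore] -/
private theorem tot_apply_coe_one (f : Gamma0Coset N → F) (γ : Gamma0 N) :
    tot u f γ ((1 : SL(2, ℤ)) : Gamma0Coset N) = u γ := by
  simp only [tot, Pi.add_apply, lift_apply_coe_one hu, cobd_apply_coe_one, add_zero]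

omit [NeZero N] in
/-- **A cocycle of `SL(2, ℤ) = ⟨S, T⟩` vanishing at `S` and `T` vanishes.** [folklore] -/
private theorem tot_eq_zero_of_S_T (f : Gamma0Coset N → F) (hS : tot u f S = 0) (hT : tot u f T = 0)
    (g : SL(2, ℤ)) : tot u f g = 0 := by
  have hg : g ∈ Subgroup.closure ({S, T} : Set SL(2, ℤ)) := by
    rw [SpecialLinearGroup.SL2Z_generators]
    exact Subgroup.mem_top g
  induction hg using Subgroup.closure_induction with
  | mem x hx =>
    rcases hx with rfl | rfl
    · exact hS
    · exact hT
  | one => exact tot_one hu f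
  | mul x y _ _ hx hy => rw [tot_mul hu, hx, hy, map_zero, add_zero]
  | inv x _ hx => rw [tot_inv hu, hx, map_zero, neg_zero]

omit [NeZero N] in
/-- `E_u(Tⁿ)(x) = ∑_{i<n} E_u(T)(Tⁱx)`. [folklore] -/
private theorem lift_T_pow_apply (n : ℕ) (x : Gamma0Coset N) :
    lift u (T ^ n) x = ∑ i ∈ Finset.range n, lift u T (T ^ i • x) := by
  induction n generalizing x with
  | zero => rw [pow_zero, lift_one hu]; simp
  | succ n ih =>
    rw [pow_succ, lift_mul hu, Pi.add_apply, coperm_apply, ih, Finset.sum_range_succ', pow_zero,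
      one_smul]
    simp_rw [smul_smul, ← pow_succ]

end Additive

/-! ### Where the cocycle conditions enter: `E(-1) = 0`, cusp sums, and the FIXED cosets of `S`, `ST` -/

omit [NeZero N] in
/-- `E_u(-1) = 0`: `ℓ(-1, x) = -1` and `u(-1) = 0` (`map_neg_one_eq_zero`). [folklore] -/
private theorem lift_neg_one (u : epCocycles N F) : lift (u : Gamma0 N → F) (-1) = 0 := by
  funext x
  simp only [lift_apply, Pi.zero_apply]
  exact map_neg_one_eq_zero u _ (coe_liftElem_neg_one x)

omit [NeZero N] in
/-- `(E_u + δf)(-1) = 0`. [folklore] -/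
private theorem tot_neg_one (u : epCocycles N F) (f : Gamma0Coset N → F) : tot (u : Gamma0 N → F) f (-1) = 0 := by
  simp [tot, lift_neg_one u, cobd, coperm_neg_one]

omit [NeZero N] in
/-- **`E_u(T^w)(x) = u(s(x)⁻¹ T^w s(x)) = 0` when `T^w x = x`, `w ≠ 0`** (`s(x)⁻¹T^ws(x)` is parabolic).
[folklore] -/
private theorem lift_T_pow_apply_eq_zero (u : epCocycles N F) {w : ℕ} (hw : w ≠ 0)
    {x : Gamma0Coset N} (hx : T ^ w • x = x) : lift (u : Gamma0 N → F) (T ^ w) x = 0 := by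
  rw [lift_apply]
  apply (mem_epCocycles_iff.mp u.2).2.1
  rw [coe_liftElem, hx]
  exact isParabolic_conj (isParabolic_T_pow hw) (sec x)

/-- **The cusp sums of `E_u(T)` vanish**: over the orbit of a base point `x` of width `w`,
`∑_{i<w} E_u(T)(Tⁱx) = E_u(T^w)(x) = 0`. [folklore] -/
private theorem cuspSum_lift_T (u : epCocycles N F) : cuspSum F N (lift (u : Gamma0 N → F) T) = 0 := by
  funext p
  obtain ⟨p, hp⟩ := p
  rw [cuspSum_apply, Pi.zero_apply, sum_orbitFin_eq,
    ← lift_T_pow_apply (mem_epCocycles_iff.mp u.2).1 (width N p) p]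
  exact lift_T_pow_apply_eq_zero u (width_pos N p).ne' (T_pow_width_smul N p)

omit [NeZero N] in
/-- Conjugates of elliptic elements are elliptic. [folklore] -/
private theorem isElliptic_conj {M : SL(2, ℤ)} (hM : (M : Matrix (Fin 2) (Fin 2) ℤ).IsElliptic)
    (A : SL(2, ℤ)) : ((A⁻¹ * M * A : SL(2, ℤ)) : Matrix (Fin 2) (Fin 2) ℤ).IsElliptic := by
  have hinv : ((A⁻¹ : SL(2, ℤ)) : Matrix (Fin 2) (Fin 2) ℤ) = (A : Matrix (Fin 2) (Fin 2) ℤ)⁻¹ := by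
    rw [Matrix.inv_def, Matrix.SpecialLinearGroup.det_coe, Ring.inverse_one, one_smul,
      Matrix.SpecialLinearGroup.coe_inv]
  rw [Matrix.SpecialLinearGroup.coe_mul, Matrix.SpecialLinearGroup.coe_mul, hinv]
  exact (Matrix.isElliptic_conj'_iff (Matrix.SpecialLinearGroup.toGL A)).mpr hM

omit [NeZero N] in
/-- `S` is elliptic (`tr S = 0`, discriminant `-4`). [folklore] -/
private theorem isElliptic_S : ((S : SL(2, ℤ)) : Matrix (Fin 2) (Fin 2) ℤ).IsElliptic := by
  rw [Matrix.IsElliptic, Matrix.discr_fin_two, Matrix.trace_fin_two, Matrix.det_fin_two]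
  norm_num [coe_S]

omit [NeZero N] in
/-- `ST` is elliptic (`tr ST = 1`, discriminant `-3`). [folklore] -/
private theorem isElliptic_ST : ((S * T : SL(2, ℤ)) : Matrix (Fin 2) (Fin 2) ℤ).IsElliptic := by
  rw [Matrix.IsElliptic, Matrix.discr_fin_two, Matrix.trace_fin_two, Matrix.det_fin_two,
    Matrix.SpecialLinearGroup.coe_mul]
  norm_num [coe_S, coe_T, Matrix.mul_apply, Fin.sum_univ_two]

omit [NeZero N] in
/-- **`E_u(g)(x) = 0` at a coset FIXED by an elliptic `g`**: `ℓ(g, x) = s(x)⁻¹ g s(x) ∈ Γ₀(N)` is a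
conjugate of `g`, hence elliptic, and `u` kills elliptic elements — the equation that replaces division by
`2` and `3` in characteristic `2` and `3`. [folklore] -/
private theorem lift_apply_eq_zero_of_isElliptic (u : epCocycles N F) {g : SL(2, ℤ)}
    (hg : (g : Matrix (Fin 2) (Fin 2) ℤ).IsElliptic) {x : Gamma0Coset N} (hx : g • x = x) :
    lift (u : Gamma0 N → F) g x = 0 := by
  rw [lift_apply]
  apply (mem_epCocycles_iff.mp u.2).2.2
  rw [coe_liftElem, hx]
  exact isElliptic_conj hg (sec x)

omit [NeZero N] in
/-- `(E_u + δf)(S)(x) = 0` when `Sx = x`. [folklore] -/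
private theorem tot_S_apply_eq_zero (u : epCocycles N F) (f : Gamma0Coset N → F) {x : Gamma0Coset N}
    (hx : S • x = x) : tot (u : Gamma0 N → F) f S x = 0 := by
  rw [tot, Pi.add_apply, lift_apply_eq_zero_of_isElliptic u isElliptic_S hx,
    cobd_apply_eq_zero_of_smul_eq f hx, add_zero]

omit [NeZero N] in
/-- `(E_u + δf)(ST)(x) = 0` when `STx = x`. [folklore] -/
private theorem tot_ST_apply_eq_zero (u : epCocycles N F) (f : Gamma0Coset N → F) {x : Gamma0Coset N}
    (hx : (S * T) • x = x) : tot (u : Gamma0 N → F) f (S * T) x = 0 := by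
  rw [tot, Pi.add_apply, lift_apply_eq_zero_of_isElliptic u isElliptic_ST hx,
    cobd_apply_eq_zero_of_smul_eq f hx, add_zero]

/-! ### The comparison map `u ⊕ f ↦ ((E_u + δf)(S), (E_u + δf)(T))` and its kernel -/

variable (F N)

/-- `u ↦ (E_u(S), E_u(T))`. [folklore] -/
def liftPair : epCocycles N F →ₗ[F] (Gamma0Coset N → F) × (Gamma0Coset N → F) where
  toFun u := (lift (u : Gamma0 N → F) S, lift (u : Gamma0 N → F) T)
  map_add' u v := by
    ext x <;> simp
  map_smul' c u := by
    ext x <;> simp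

/-- `f ↦ (δf(S), δf(T))`. [folklore] -/
def cobdPair : (Gamma0Coset N → F) →ₗ[F] (Gamma0Coset N → F) × (Gamma0Coset N → F) where
  toFun f := (cobd f S, cobd f T)
  map_add' f f' := by
    ext x <;> simp [cobd] <;> ring
  map_smul' c f := by
    ext x <;> simp [cobd] <;> ring

/-- The **comparison map** `Λ(u, f) = ((E_u + δf)(S), (E_u + δf)(T))` on `Z¹_EP(Γ₀(N), F) ⊕ F^X`.
[folklore] -/
def lam : (epCocycles N F × (Gamma0Coset N → F)) →ₗ[F] (Gamma0Coset N → F) × (Gamma0Coset N → F) :=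
  (liftPair F N).coprod (cobdPair F N)

variable {F N}

omit [NeZero N] in
/-- Unfolding `lam`. [folklore] -/
private theorem lam_apply (p : epCocycles N F × (Gamma0Coset N → F)) :
    lam F N p = (tot (p.1 : Gamma0 N → F) p.2 S, tot (p.1 : Gamma0 N → F) p.2 T) := rfl

omit [NeZero N] in
/-- **The kernel of `Λ` is `0 ⊕ (constants)`**: if `(E_u + δf)(S) = (E_u + δf)(T) = 0` then `E_u + δf = 0`
on `SL(2, ℤ) = ⟨S, T⟩`, so `u(γ) = (E_u + δf)(γ)(Γ₀(N)) = 0`, and then `g^*f = f` for all `g`, i.e. `f` is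
constant (`SL(2, ℤ)` is transitive on `X`). [folklore] -/
private theorem ker_lam_le (p : epCocycles N F × (Gamma0Coset N → F)) (hp : p ∈ LinearMap.ker (lam F N)) :
    p.1 = 0 ∧ ∀ x, p.2 x = p.2 ((1 : SL(2, ℤ)) : Gamma0Coset N) := by
  obtain ⟨u, f⟩ := p
  have hu := (mem_epCocycles_iff.mp u.2).1
  rw [LinearMap.mem_ker, lam_apply, Prod.mk_eq_zero] at hp
  have hall := tot_eq_zero_of_S_T hu f hp.1 hp.2
  have hu0 : u = 0 := by
    apply Subtype.ext
    funext γ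
    have h := tot_apply_coe_one hu f γ
    rw [hall, Pi.zero_apply] at h
    simp [← h]
  refine ⟨hu0, fun x ↦ ?_⟩
  have hcobd : ∀ g, cobd f g = 0 := fun g ↦ by
    have h := hall g
    rw [tot, hu0] at h
    have h0 : lift ((0 : epCocycles N F) : Gamma0 N → F) g = 0 := by
      funext y
      simp
    rwa [h0, zero_add] at h
  have hx : x = sec x • ((1 : SL(2, ℤ)) : Gamma0Coset N) := by
    rw [MulAction.Quotient.smul_mk, smul_eq_mul, mul_one, coe_sec]
  have h := congr_fun (hcobd (sec x)) ((1 : SL(2, ℤ)) : Gamma0Coset N)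
  rw [cobd, Pi.sub_apply, coperm_apply, Pi.zero_apply, sub_eq_zero, ← hx] at h
  exact h

omit [NeZero N] in
/-- `dim ker Λ ≤ 1`. [folklore] -/
private theorem finrank_ker_lam_le_one : finrank F (LinearMap.ker (lam F N)) ≤ 1 := by
  let φ : LinearMap.ker (lam F N) →ₗ[F] F :=
    { toFun := fun p ↦ (p : epCocycles N F × (Gamma0Coset N → F)).2
        ((1 : SL(2, ℤ)) : Gamma0Coset N)
      map_add' := fun _ _ ↦ rfl
      map_smul' := fun _ _ ↦ rfl }
  have hφ : Function.Injective φ := by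
    intro p q hpq
    obtain ⟨hp1, hp2⟩ := ker_lam_le p.1 p.2
    obtain ⟨hq1, hq2⟩ := ker_lam_le q.1 q.2
    apply Subtype.ext
    apply Prod.ext
    · rw [hp1, hq1]
    · funext x
      rw [hp2 x, hq2 x]
      exact hpq
  have h := LinearMap.finrank_le_finrank_of_injective hφ
  rwa [Module.finrank_self] at h

/-! ### The three linear conditions on `((E_u + δf)(S), (E_u + δf)(T))` and their solution space -/

variable (F N)

/-- The **solution space** `W ⊆ F^X × F^X`: `a ∈ K_S`, `T^*a + b ∈ K_U`, `cusp sums of b = 0`. [folklore] -/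
def solSpace : Submodule F ((Gamma0Coset N → F) × (Gamma0Coset N → F)) :=
  (kerS F N).comap (LinearMap.fst F _ _) ⊓
    ((kerU F N).comap (coperm T ∘ₗ LinearMap.fst F _ _ + LinearMap.snd F _ _) ⊓
      LinearMap.ker (cuspSum F N ∘ₗ LinearMap.snd F _ _))

/-- Membership in `solSpace`. [folklore] -/
private theorem mem_solSpace_iff (p : (Gamma0Coset N → F) × (Gamma0Coset N → F)) :
    p ∈ solSpace F N ↔ p.1 ∈ kerS F N ∧ coperm T p.1 + p.2 ∈ kerU F N ∧ cuspSum F N p.2 = 0 := by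
  simp [solSpace]

/-- **`Λ` lands in the solution space**: `S^*E(S) + E(S) = E(S²) = E(-1) = 0` and `E(S)` vanishes on the
`S`-fixed cosets; `T^*E(S) + E(T) = E(ST)` satisfies `(1 + U + U²)E(ST) = E((ST)³) = E(-1) = 0` and
vanishes on the `ST`-fixed cosets; the cusp sums of `E(T) = E_u(T) + T^*f - f` vanish. [folklore] -/
private theorem range_lam_le : LinearMap.range (lam F N) ≤ solSpace F N := by
  rintro _ ⟨⟨u, f⟩, rfl⟩
  have hu := (mem_epCocycles_iff.mp u.2).1
  rw [mem_solSpace_iff, lam_apply]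
  have hST : tot (u : Gamma0 N → F) f (S * T) = coperm T (tot (u : Gamma0 N → F) f S) +
      tot (u : Gamma0 N → F) f T := tot_mul hu f S T
  refine ⟨?_, ?_, ?_⟩
  · rw [mem_kerS_iff]
    refine ⟨fun x ↦ ?_, fun x hx ↦ tot_S_apply_eq_zero u f hx⟩
    have h := tot_mul hu f S S
    rw [S_mul_S_eq_neg_one, tot_neg_one u] at h
    have hx := congr_fun h x
    rw [Pi.zero_apply, Pi.add_apply, coperm_apply] at hx
    exact eq_neg_of_add_eq_zero_left hx.symm
  · change coperm T (tot (u : Gamma0 N → F) f S) + tot (u : Gamma0 N → F) f T ∈ kerU F N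
    rw [← hST, mem_kerU_iff]
    refine ⟨fun x ↦ ?_, fun x hx ↦ tot_ST_apply_eq_zero u f hx⟩
    have h3 := tot_mul hu f (S * T * (S * T)) (S * T)
    rw [ParabolicCount.ST_pow_three_eq, tot_neg_one u, tot_mul hu f (S * T) (S * T), map_add] at h3
    have hx := congr_fun h3 x
    simp only [Pi.zero_apply, Pi.add_apply, coperm_apply] at hx
    linear_combination -hx
  · change cuspSum F N (tot (u : Gamma0 N → F) f T) = 0
    rw [tot, map_add, cuspSum_lift_T u, zero_add, cobd, map_sub, cuspSum_coperm_T, sub_self]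

/-- **`dim W ≤ dim K_S + dim(K_U ∩ ker(cusp sums))`**: project `W` to the first factor; the fibre over
`a = 0` is `K_U ∩ ker(cusp sums)`. [folklore] -/
private theorem finrank_solSpace_le :
    finrank F (solSpace F N) ≤ finrank F (kerS F N) +
      finrank F ↥(kerU F N ⊓ LinearMap.ker (cuspSum F N)) := by
  let π : solSpace F N →ₗ[F] (Gamma0Coset N → F) := LinearMap.fst F _ _ ∘ₗ (solSpace F N).subtype
  have hπ := LinearMap.finrank_range_add_finrank_ker π
  have hrange : LinearMap.range π ≤ kerS F N := by
    rintro _ ⟨p, rfl⟩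
    exact ((mem_solSpace_iff F N p.1).mp p.2).1
  have h1 := Submodule.finrank_mono hrange
  let ψ : LinearMap.ker π →ₗ[F] (Gamma0Coset N → F) :=
    LinearMap.snd F _ _ ∘ₗ (solSpace F N).subtype ∘ₗ (LinearMap.ker π).subtype
  have hker : ∀ p : LinearMap.ker π,
      ((p : solSpace F N) : (Gamma0Coset N → F) × (Gamma0Coset N → F)).1 = 0 :=
    fun p ↦ LinearMap.mem_ker.mp p.2
  have hψinj : Function.Injective ψ := by
    intro p q hpq
    apply Subtype.ext
    apply Subtype.ext
    exact Prod.ext (by rw [hker p, hker q]) hpq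
  have hψrange : LinearMap.range ψ ≤ kerU F N ⊓ LinearMap.ker (cuspSum F N) := by
    rintro _ ⟨p, rfl⟩
    obtain ⟨-, h2, h3⟩ := (mem_solSpace_iff F N _).mp (p : solSpace F N).2
    rw [hker p, map_zero, zero_add] at h2
    exact ⟨h2, h3⟩
  have h2 := Submodule.finrank_mono hψrange
  rw [LinearMap.finrank_range_of_inj hψinj] at h2
  omega

/-! ### The count -/

/-- **`dim_F Z¹_EP(Γ₀(N), F) ≤ 2g(X₀(N))` for every field `F`**, in the form
`6 dim_F Z¹_EP + 3ε₂ + 4ε₃ + 6ε_∞ ≤ 12 + μ` (`μ = [SL(2, ℤ) : Γ₀(N)]`, `ε₂ = #{x : Sx = x}`,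
`ε₃ = #{x : TSx = x}`, `ε_∞` the number of cusps, so `12g = 12 + μ - 3ε₂ - 4ε₃ - 6ε_∞`): Shimura's
count (8.2.24) (case `n = 0`) by Shapiro's lemma and linear algebra in `F^X`, valid in EVERY
characteristic because the homomorphisms also kill the elliptic elements:
`dim Z + μ ≤ dim ker Λ + dim W ≤ 1 + dim K_S + dim K_U + (μ - ε_∞) + 1 - μ` with `2 dim K_S ≤ μ - ε₂`,
`3 dim K_U ≤ 2μ - 2ε₃`. [cite: ShimuraIATAF1971, §8.2 (8.2.24) with Prop. 8.3 (case n = 0)] -/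
theorem six_mul_finrank_epCocycles_le :
    6 * finrank F (epCocycles N F) + 3 * Nat.card {q : SL(2, ℤ) ⧸ Gamma0 N // S • q = q} +
        4 * Nat.card {q : SL(2, ℤ) ⧸ Gamma0 N // (T * S) • q = q} +
        6 * Nat.card (CuspOrbits (Gamma0 N : Subgroup (GL (Fin 2) ℝ))) ≤
      12 + (Gamma0 N).index := by
  haveI := finite_epCocycles N F
  -- notation and the numerical inputs
  have hμ : (Gamma0 N).index = Fintype.card (Gamma0Coset N) := by
    rw [Subgroup.index, Nat.card_eq_fintype_card]
  have hε₂ : Nat.card {q : SL(2, ℤ) ⧸ Gamma0 N // S • q = q} =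
      (Finset.univ.filter fun q : Gamma0Coset N ↦ S • q = q).card := by
    rw [Nat.card_eq_fintype_card, Fintype.card_subtype]
  have hε₃ : Nat.card {q : SL(2, ℤ) ⧸ Gamma0 N // (T * S) • q = q} =
      (Finset.univ.filter fun q : Gamma0Coset N ↦ (S * T) • q = q).card := by
    rw [card_fixed_TS_eq_card_fixed_ST, Nat.card_eq_fintype_card, Fintype.card_subtype]
  have hε : Nat.card (CuspOrbits (Gamma0 N : Subgroup (GL (Fin 2) ℝ))) = (basePoints N).card := by
    rw [card_basePoints, ← numCusps_eq_nuInfty_holds N, numCusps]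
  have hS := two_mul_finrank_kerS_add_le (F := F) (N := N)
  have hU := three_mul_finrank_kerU_add_le (F := F) (N := N)
  have hC := finrank_range_cuspSum (F := F) (N := N)
  have hC' := LinearMap.finrank_range_add_finrank_ker (cuspSum F N)
  rw [finrank_fintype_fun_eq_card] at hC'
  -- `dim (K_U ∩ ker C) + μ ≤ dim K_U + dim ker C + 1`
  have hsup := Submodule.finrank_sup_add_finrank_inf_eq (kerU F N) (LinearMap.ker (cuspSum F N))
  have hcodim := card_le_finrank_kerU_sup_add_one (F := F) (N := N)
  -- `dim Z + μ = dim ker Λ + dim range Λ ≤ 1 + dim W`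
  have hΛ := LinearMap.finrank_range_add_finrank_ker (lam F N)
  rw [Module.finrank_prod, finrank_fintype_fun_eq_card] at hΛ
  have hker := finrank_ker_lam_le_one (F := F) (N := N)
  have hrange := Submodule.finrank_mono (range_lam_le F N)
  have hW := finrank_solSpace_le F N
  rw [hμ, hε₂, hε₃, hε]
  omega

end EPCount

/-! ### `dim_F Z¹_EP(Γ₀(N), F) ≤ 2 dim_ℂ S₂(Γ₀(N))` -/

section Count

variable (N : ℕ) [NeZero N] (F : Type*) [Field F]

/-- **`dim_F Z¹_EP(Γ₀(N), F) ≤ 2 dim_ℂ S₂(Γ₀(N))` for every field `F` and every `N ≥ 1`**: the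
group-cohomological bound `6 dim Z¹_EP + 3ε₂ + 4ε₃ + 6ε_∞ ≤ 12 + μ` (`EPCount.six_mul_finrank_epCocycles_le`)
against the genus formula `12 dim S₂(Γ₀(N)) + 3ε₂ + 4ε₃ + 6ε_∞ = 12 + μ`
(`twelve_mul_finrank_cuspForm_two_gamma0_holds`).  In words: `Γ₀(N)ᵃᵇ/Γ_epᵃᵇ` admits at most `2g`
independent homomorphisms to ANY field. [cite: ShimuraIATAF1971, §8.2 (8.2.23)–(8.2.24)]
[cite: Knapp1993, Prop. 11.22 (PDF p. 242)] -/
theorem finrank_epCocycles_le_two_mul_finrank :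
    Module.finrank F (epCocycles N F) ≤ 2 * Module.finrank ℂ (CuspForm (Gamma0 N) 2) := by
  have h₁ := EPCount.six_mul_finrank_epCocycles_le F N
  have h₂ := twelve_mul_finrank_cuspForm_two_gamma0_holds N (Gamma0_is_congruence N)
  rw [adjoinNegI_gamma0, ellipticPointCount_two_gamma0_eq_card,
    ellipticPointCount_three_gamma0_eq_card] at h₂
  omega

end Count

end Literature.NumberTheory.ModularSymbols
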